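import Summits.QuantumFields.YangMills.Theorems.BalabanLadderIRcofEquipartitionSeamSliceKernelBlockCore
import HarnessLib

/-!
# Crux `IRcof` (stmt-QuantumFields-26930) · line `equipartition_seam` (row 47) · located stub **L `SpectralDict.SliceRealisationV`** —
# PART 3 ∕ 4 — Stage C (the block as a one-bond insertion, `blockKernel_eq_integral_core`, `block_inner`) and Stages B+D (`integral_layers_eq_blockChain`: layers ↦ block chain)

SOURCE OF RECORD: `Cruxes/IRcof/Lines/equipartition_seam_SliceRealisation.lean` rev 1 (crux write 0079346b2e66, 1445 l., 77 decls; author ideator ym-ir-idea-22 g8; LAND-ASK «stub L» bus l.≈1828; critic ym-ir-crit-3 g6 TYPEREAD asked there) — cut VERBATIM at its `PART k` banners into ≤ 400-line Theorems files by LEAD prover ym-ir-line-ab-p1 g8, each importing the previous; the author's `set_option maxHeartbeats 400000 in` lines (six, pre-budgeted per ops-buildfix-2) are kept verbatim.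

HONEST FRAMING.  Finite-box Fubini ∕ Haar bookkeeping (the transfer-operator REALISATION of the split-weight sector functions); it closes the LOCATED typing stub L `SpectralDict.SliceRealisationV` of row 47 only in PART 4 and proves NO constructive-QFT estimate: the located stubs S1 · S3ʷ · T · N · S5ᵛ stay open; row 47 class PWP, mechanism 0, width 0; `IRcof` ∕ `IR` 0∕1; the Yang–Mills mass gap (Clay) is NOT proved by anything in this tree; R4 closes only the conditional finite-𝕋⁴ rung `BalabanLadder.UV`.
-/

noncomputable section

open MeasureTheory ProbabilityTheory Finset Filter Function
open scoped BigOperators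

namespace Summit.QuantumFields.YangMills.Cruxes.IRcof.EquipartitionSeam.SliceKernel

open Literature.MathematicalPhysics.QuantumFieldTheory (haarProbability)
open Literature.Analysis.OperatorTheory (measurePreserving_finSplit finSplit_apply_fst finSplit_apply_snd
  integral_pi_comp_perm)
open Summit.QuantumFields.YangMills.Cruxes.IRcof.EquipartitionSeam.SpectralDict (pathK)

/-- `|x·y| ≤ A·B` from `|x| ≤ A`, `|y| ≤ B` — private copy (PART 2's is `private`; the public twin is `Literature.Analysis.FluidPDE.CompressibleEuler.abs_mul_le_of_le`, gate dedup.landed). -/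
private theorem abs_mul_le_mul {x y A B : ℝ} (hx : |x| ≤ A) (hy : |y| ≤ B) : |x * y| ≤ A * B := by
  rw [abs_mul]; exact mul_le_mul hx hy (abs_nonneg _) ((abs_nonneg _).trans hx)

/-! ## PART 3 — Stage C (the block as a one-bond insertion) and Stages B+D (layers ↦ block chain) -/

section BlockChain

variable {P Λ H : Type*} [Fintype P] [Fintype Λ] [Group H] [TopologicalSpace H] [IsTopologicalGroup H]
  [CompactSpace H] [MeasurableSpace H] [BorelSpace H] (src tgt : Λ → P) (w : H → ℝ) (a : (Λ → H) → ℝ)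

variable [SecondCountableTopology H]

/-! ### Stage C: the block integrates to the one-bond insertion `∫ K(p,u) Bk(u,v) K(z⁻¹•v, q)` -/

/-- The block kernel with its temporal layers integrated first: `a u · (∫ ∏ a(xₖ)² · core(u, x, v) dx) · a v`. -/
theorem blockKernel_eq_integral_core (hw : Continuous w) (hw0 : ∀ h, 0 ≤ w h) {Cw : ℝ} (hwC : ∀ h, w h ≤ Cw)
    (ha : Measurable a) {Ca : ℝ} (haC : ∀ V, |a V| ≤ Ca) (M r : ℕ)
    {F : (Fin ((M + 3) + (r + 2)) → Λ → H) × (Fin ((M + 3) + (r + 2)) → P → H) → ℝ} (hFm : Measurable F)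
    {nrm : ℝ} (hFb : ∀ q, |F q| ≤ nrm) (u v : Λ → H) :
    blockKernel src tgt w a M r F u v =
      a u * (∫ x : Fin r → Λ → H, (∏ k, a (x k) ^ 2) * core src tgt w M r F (Fin.cons u (Fin.snoc x v))
        ∂(Measure.pi fun _ => Measure.pi fun _ : Λ => haarProbability H)) * a v := by
  have hpair : Measurable fun qq : (Fin r → Λ → H) × (Fin (r + 1) → P → H) =>
      (((u, v) : (Λ → H) × (Λ → H)), qq) := measurable_const.prodMk measurable_id
  have hmeas := (measurable_blockIntegrand src tgt w a hw ha M r hFm).comp hpair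
  have hint : Integrable (fun qq : (Fin r → Λ → H) × (Fin (r + 1) → P → H) =>
      F (padV M (Fin.cons u (Fin.snoc qq.1 v)), padE M qq.2) *
        ((∏ i, a (qq.1 i) ^ 2) * ∏ b : Fin (r + 1), tempKernel src tgt w
          ((Fin.cons u (Fin.snoc qq.1 v) : Fin (r + 2) → Λ → H) (Fin.castSucc b)) (qq.2 b)
          ((Fin.cons u (Fin.snoc qq.1 v) : Fin (r + 2) → Λ → H) (Fin.succ b))))
      ((Measure.pi fun _ => Measure.pi fun _ : Λ => haarProbability H).prod
        (Measure.pi fun _ => Measure.pi fun _ : P => haarProbability H)) :=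
    (integrable_const (nrm * ((Ca ^ 2) ^ r * (Cw ^ Fintype.card Λ) ^ (r + 1)))).mono'
      hmeas.aestronglyMeasurable
      (Eventually.of_forall fun qq => norm_blockIntegrand_le src tgt w a hw0 hwC haC M r hFb ((u, v), qq))
  unfold blockKernel
  rw [integral_prod _ hint]
  refine congrArg (fun t => a u * t * a v) (integral_congr_ae (Eventually.of_forall fun x => ?_))
  dsimp only
  unfold core
  rw [← integral_const_mul]
  refine integral_congr_ae (Eventually.of_forall fun Eb => ?_)
  dsimp only
  ring

set_option maxHeartbeats 400000 in
/-- **The block as a one-bond insertion.**  For fixed neighbour slices `p` (before the block) and `q` (after the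
seam), the integral over the `r + 2` block slices of (bond into the block) · (seam bond out of the block) ·
(block magnetic weights) · (block layer integral), sandwiched by `a p`, `a q`, is
`∫∫ K(p, u) Bk(u, v) K(z⁻¹ • v, q) du dv` with `K = sandKernel`, `Bk = blockKernel`. -/
theorem block_inner (hw : Continuous w) (hw0 : ∀ h, 0 ≤ w h) {Cw : ℝ} (hwC : ∀ h, w h ≤ Cw)
    (ha : Measurable a) {Ca : ℝ} (haC : ∀ V, |a V| ≤ Ca) {z : Λ → H} (hz : ∀ l, z l ∈ Subgroup.center H)
    (haT : ∀ V, a (ctwist z⁻¹ V) = a V) (M r : ℕ)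
    {F : (Fin ((M + 3) + (r + 2)) → Λ → H) × (Fin ((M + 3) + (r + 2)) → P → H) → ℝ} (hFm : Measurable F)
    {nrm : ℝ} (hFb : ∀ q, |F q| ≤ nrm) (p q : Λ → H) :
    a p * (∫ Vb : Fin (r + 2) → Λ → H,
        avgKernel src tgt w p (Vb 0) * (avgKernel src tgt w (Vb (Fin.last (r + 1))) (ctwist z q) *
          ((∏ i, a (Vb i) ^ 2) * core src tgt w M r F Vb))
      ∂(Measure.pi fun _ => Measure.pi fun _ : Λ => haarProbability H)) * a q =
    ∫ u, sandKernel src tgt w a p u *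
        ∫ v, blockKernel src tgt w a M r F u v * sandKernel src tgt w a (ctwist z⁻¹ v) q
        ∂(Measure.pi fun _ : Λ => haarProbability H) ∂(Measure.pi fun _ : Λ => haarProbability H) := by
  -- the block-slice integrand: measurable and bounded
  have hq1 : ∀ i : Fin (r + 2), Measurable fun Vb : Fin (r + 2) → Λ → H => Vb i := fun i => measurable_pi_apply i
  have hav0 : Measurable fun Vb : Fin (r + 2) → Λ → H => avgKernel src tgt w p (Vb 0) :=
    measurable_avgKernel_comp₂ src tgt w hw measurable_const (hq1 0)
  have hav1 : Measurable fun Vb : Fin (r + 2) → Λ → H =>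
      avgKernel src tgt w (Vb (Fin.last (r + 1))) (ctwist z q) :=
    measurable_avgKernel_comp₂ src tgt w hw (hq1 (Fin.last (r + 1))) measurable_const
  have hpr : Measurable fun Vb : Fin (r + 2) → Λ → H => ∏ i, a (Vb i) ^ 2 :=
    Finset.measurable_prod _ fun i _ => ((ha.comp (hq1 i)).pow_const 2)
  have hhm : Measurable fun Vb : Fin (r + 2) → Λ → H =>
      avgKernel src tgt w p (Vb 0) * (avgKernel src tgt w (Vb (Fin.last (r + 1))) (ctwist z q) *
        ((∏ i, a (Vb i) ^ 2) * core src tgt w M r F Vb)) :=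
    hav0.mul (hav1.mul (hpr.mul (measurable_core src tgt w hw M r hFm)))
  have hhb : ∀ Vb : Fin (r + 2) → Λ → H,
      ‖avgKernel src tgt w p (Vb 0) * (avgKernel src tgt w (Vb (Fin.last (r + 1))) (ctwist z q) *
        ((∏ i, a (Vb i) ^ 2) * core src tgt w M r F Vb))‖ ≤
        Cw ^ Fintype.card Λ * (Cw ^ Fintype.card Λ * ((Ca ^ 2) ^ (r + 2) * (nrm * (Cw ^ Fintype.card Λ) ^ (r + 1)))) := by
    intro Vb
    rw [Real.norm_eq_abs]
    refine abs_mul_le_mul (abs_avgKernel_le src tgt w hw0 hwC _ _)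
      (abs_mul_le_mul (abs_avgKernel_le src tgt w hw0 hwC _ _)
        (abs_mul_le_mul (abs_prod_sq_le a haC Vb) ?_))
    rw [← Real.norm_eq_abs]; exact norm_core_le src tgt w hw0 hwC M r hFb Vb
  have hconsm : ∀ u : Λ → H, Measurable fun W : Fin (r + 1) → Λ → H => (Fin.cons u W : Fin (r + 2) → Λ → H) :=
    fun u => (Literature.Analysis.OperatorTheory.measurable_finCons (r + 1)).comp
      (measurable_const.prodMk measurable_id)
  -- split off `u = Vb 0`, then `v = Vb (last)`
  rw [Literature.Analysis.OperatorTheory.integral_pi_succ_eq_integral_cons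
    (ρ := Measure.pi fun _ : Λ => haarProbability H) (r + 1) hhm hhb]
  have hsnoc : ∀ u : Λ → H,
      ∫ W : Fin (r + 1) → Λ → H, avgKernel src tgt w p ((Fin.cons u W : Fin (r + 2) → Λ → H) 0) *
          (avgKernel src tgt w ((Fin.cons u W : Fin (r + 2) → Λ → H) (Fin.last (r + 1))) (ctwist z q) *
            ((∏ i, a ((Fin.cons u W : Fin (r + 2) → Λ → H) i) ^ 2) *
              core src tgt w M r F (Fin.cons u W)))
        ∂(Measure.pi fun _ => Measure.pi fun _ : Λ => haarProbability H) =
      ∫ v, ∫ x : Fin r → Λ → H, avgKernel src tgt w p ((Fin.cons u (Fin.snoc x v) : Fin (r + 2) → Λ → H) 0) *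
          (avgKernel src tgt w ((Fin.cons u (Fin.snoc x v) : Fin (r + 2) → Λ → H) (Fin.last (r + 1)))
              (ctwist z q) *
            ((∏ i, a ((Fin.cons u (Fin.snoc x v) : Fin (r + 2) → Λ → H) i) ^ 2) *
              core src tgt w M r F (Fin.cons u (Fin.snoc x v))))
        ∂(Measure.pi fun _ => Measure.pi fun _ : Λ => haarProbability H)
        ∂(Measure.pi fun _ : Λ => haarProbability H) := fun u =>
    integral_pi_succ_eq_integral_snoc (Measure.pi fun _ : Λ => haarProbability H) r (hhm.comp (hconsm u))
      (fun W => hhb _)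
  simp only [hsnoc]
  -- the chain's end points and interior
  have hprod : ∀ (u v : Λ → H) (x : Fin r → Λ → H),
      ∏ i, a ((Fin.cons u (Fin.snoc x v) : Fin (r + 2) → Λ → H) i) ^ 2 = a u ^ 2 * a v ^ 2 * ∏ k, a (x k) ^ 2 := by
    intro u v x
    rw [← sq_mul_sq_mul_prod_eq r (fun V => a V ^ 2) (Fin.cons u (Fin.snoc x v))]
    simp only [Fin.cons_zero, consSnoc_last, consSnoc_castSucc_succ]
  simp only [Fin.cons_zero, consSnoc_last, hprod]
  have hBk := blockKernel_eq_integral_core src tgt w a hw hw0 hwC ha haC M r hFm hFb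
  have hKav : ∀ v, sandKernel src tgt w a (ctwist z⁻¹ v) q = a v * avgKernel src tgt w v (ctwist z q) * a q := by
    intro v
    rw [sandKernel, haT, ← avgKernel_ctwist src tgt w hz (ctwist z⁻¹ v) q, ctwist_ctwist_inv]
  simp only [hBk, hKav]
  rw [← integral_const_mul, ← integral_mul_const]
  refine integral_congr_ae (Eventually.of_forall fun u => ?_)
  dsimp only
  have hx : ∀ v : Λ → H, ∫ x : Fin r → Λ → H, avgKernel src tgt w p u *
        (avgKernel src tgt w v (ctwist z q) * (a u ^ 2 * a v ^ 2 * (∏ k, a (x k) ^ 2) *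
          core src tgt w M r F (Fin.cons u (Fin.snoc x v))))
        ∂(Measure.pi fun _ => Measure.pi fun _ : Λ => haarProbability H) =
      (avgKernel src tgt w p u * avgKernel src tgt w v (ctwist z q) * (a u ^ 2 * a v ^ 2)) *
        ∫ x : Fin r → Λ → H, (∏ k, a (x k) ^ 2) * core src tgt w M r F (Fin.cons u (Fin.snoc x v))
          ∂(Measure.pi fun _ => Measure.pi fun _ : Λ => haarProbability H) := by
    intro v
    rw [← integral_const_mul]
    refine integral_congr_ae (Eventually.of_forall fun x => ?_)
    dsimp only
    ring
  simp only [hx]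
  rw [sandKernel, ← integral_const_mul, ← integral_mul_const, ← integral_const_mul]
  refine integral_congr_ae (Eventually.of_forall fun v => ?_)
  dsimp only
  ring


/-! ### Stage B + D: the temporal transfer-operator form of a windowed section -/

set_option maxHeartbeats 400000 in
/-- **Layers ↦ block chain** (the abstract heart of the located stub `L`).  The joint slice/layer integral of
`F · ∏ₜ Mg(Vₜ) · ∏ₜ tempKernel(Vₜ, Eₜ, seam • V_{t+1})` — species `F` reading only the block (slices
`natAdd i`, layers `natAdd b.castSucc`), seam `z` on the layer after the block, `Mg = a²` — equals the cyclic
`sandKernel`-chain of length `M + 3` with ONE bond replaced by the insertion `∫∫ K(V₀,u) Bk(u,v) K(z⁻¹ • v, V₁)`,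
`Bk = blockKernel`.  Stage A integrates the layers out, Stage B is Fubini + the splitting of the slices into
(outer, block), Stage C (`block_inner`) re-sandwiches the block, Stage D relabels the outer cycle by
`(finRotate (M+3)).symm`. -/
theorem integral_layers_eq_blockChain (hw : Continuous w) (hw0 : ∀ h, 0 ≤ w h) {Cw : ℝ} (hwC : ∀ h, w h ≤ Cw)
    (ha : Measurable a) {Ca : ℝ} (haC : ∀ V, |a V| ≤ Ca) {Mg : (Λ → H) → ℝ} (hMg : ∀ V, Mg V = a V ^ 2)
    {z : Λ → H} (hz : ∀ l, z l ∈ Subgroup.center H) (haT : ∀ V, a (ctwist z⁻¹ V) = a V) (M r : ℕ)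
    {F : (Fin ((M + 3) + (r + 2)) → Λ → H) × (Fin ((M + 3) + (r + 2)) → P → H) → ℝ} (hFm : Measurable F)
    {nrm : ℝ} (hFb : ∀ q, |F q| ≤ nrm)
    (hFdep : ∀ q q' : (Fin ((M + 3) + (r + 2)) → Λ → H) × (Fin ((M + 3) + (r + 2)) → P → H),
      (∀ i, q.1 (Fin.natAdd (M + 3) i) = q'.1 (Fin.natAdd (M + 3) i)) →
      (∀ b : Fin (r + 1), q.2 (Fin.natAdd (M + 3) (Fin.castSucc b)) = q'.2 (Fin.natAdd (M + 3) (Fin.castSucc b))) →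
        F q = F q')
    {sm : Fin ((M + 3) + (r + 2)) → Λ → H} (hsm₁ : sm (Fin.natAdd (M + 3) (Fin.last (r + 1))) = z)
    (hsm₀ : ∀ t, t ≠ Fin.natAdd (M + 3) (Fin.last (r + 1)) → sm t = 1) :
    ∫ q : (Fin ((M + 3) + (r + 2)) → Λ → H) × (Fin ((M + 3) + (r + 2)) → P → H),
        F q * ((∏ t, Mg (q.1 t)) *
          ∏ t, tempKernel src tgt w (q.1 t) (q.2 t) (ctwist (sm t) (q.1 (finRotate _ t))))
      ∂((Measure.pi fun _ => Measure.pi fun _ : Λ => haarProbability H).prod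
          (Measure.pi fun _ => Measure.pi fun _ : P => haarProbability H)) =
    ∫ V : Fin (M + 3) → Λ → H,
        (∫ u, sandKernel src tgt w a (V 0) u *
            ∫ v, blockKernel src tgt w a M r F u v * sandKernel src tgt w a (ctwist z⁻¹ v) (V 1)
            ∂(Measure.pi fun _ : Λ => haarProbability H) ∂(Measure.pi fun _ : Λ => haarProbability H)) *
          ∏ t : Fin (M + 2), sandKernel src tgt w a (V t.succ) (V (t.succ + 1))
      ∂(Measure.pi fun _ => Measure.pi fun _ : Λ => haarProbability H) := by
  simp only [hMg]
  /- (B1) Fubini over (slices, layers) -/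
  have hsmm : ∀ t, Measurable (ctwist (sm t) : (Λ → H) → Λ → H) := fun t => (continuous_ctwist (sm t)).measurable
  have hq1 : ∀ t, Measurable fun q : (Fin ((M + 3) + (r + 2)) → Λ → H) × (Fin ((M + 3) + (r + 2)) → P → H) => q.1 t :=
    fun t => (measurable_pi_apply t).comp measurable_fst
  have hq2 : ∀ t, Measurable fun q : (Fin ((M + 3) + (r + 2)) → Λ → H) × (Fin ((M + 3) + (r + 2)) → P → H) => q.2 t :=
    fun t => (measurable_pi_apply t).comp measurable_snd
  have hΨm : Measurable fun q : (Fin ((M + 3) + (r + 2)) → Λ → H) × (Fin ((M + 3) + (r + 2)) → P → H) =>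
      F q * ((∏ t, a (q.1 t) ^ 2) *
        ∏ t, tempKernel src tgt w (q.1 t) (q.2 t) (ctwist (sm t) (q.1 (finRotate _ t)))) :=
    hFm.mul ((Finset.measurable_prod _ fun t _ => (ha.comp (hq1 t)).pow_const 2).mul
      (Finset.measurable_prod _ fun t _ => measurable_tempKernel_comp₃ src tgt w hw (hq1 t) (hq2 t)
        ((hsmm t).comp (hq1 (finRotate _ t)))))
  have hΨb : ∀ q : (Fin ((M + 3) + (r + 2)) → Λ → H) × (Fin ((M + 3) + (r + 2)) → P → H),
      ‖F q * ((∏ t, a (q.1 t) ^ 2) *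
        ∏ t, tempKernel src tgt w (q.1 t) (q.2 t) (ctwist (sm t) (q.1 (finRotate _ t))))‖ ≤
        nrm * ((Ca ^ 2) ^ ((M + 3) + (r + 2)) * (Cw ^ Fintype.card Λ) ^ ((M + 3) + (r + 2))) := by
    intro q
    rw [Real.norm_eq_abs]
    refine abs_mul_le_mul (hFb q) (abs_mul_le_mul (abs_prod_sq_le a haC q.1) ?_)
    have h := abs_prod_tempKernel_le src tgt w hw0 hwC q.1 (fun t => ctwist (sm t) (q.1 (finRotate _ t))) q.2
    rwa [Fintype.card_fin] at h
  have hint : Integrable (fun q : (Fin ((M + 3) + (r + 2)) → Λ → H) × (Fin ((M + 3) + (r + 2)) → P → H) =>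
      F q * ((∏ t, a (q.1 t) ^ 2) *
        ∏ t, tempKernel src tgt w (q.1 t) (q.2 t) (ctwist (sm t) (q.1 (finRotate _ t)))))
      ((Measure.pi fun _ => Measure.pi fun _ : Λ => haarProbability H).prod
        (Measure.pi fun _ => Measure.pi fun _ : P => haarProbability H)) :=
    (integrable_const _).mono' hΨm.aestronglyMeasurable (Eventually.of_forall hΨb)
  rw [integral_prod _ hint]
  /- (B2) at fixed slices: constants out, layers by Stage A, read through the splitting of the slices -/
  have hV : ∀ V : Fin ((M + 3) + (r + 2)) → Λ → H,
      ∫ E : Fin ((M + 3) + (r + 2)) → P → H, F (V, E) * ((∏ t, a (V t) ^ 2) *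
          ∏ t, tempKernel src tgt w (V t) (E t) (ctwist (sm t) (V (finRotate _ t))))
        ∂(Measure.pi fun _ => Measure.pi fun _ : P => haarProbability H) =
      (fun pV : (Fin (M + 3) → Λ → H) × (Fin (r + 2) → Λ → H) =>
        ((∏ j, a (pV.1 j) ^ 2) * ∏ j : Fin (M + 2), avgKernel src tgt w (pV.1 (Fin.castSucc j)) (pV.1 j.succ)) *
          (avgKernel src tgt w (pV.1 (Fin.last (M + 2))) (pV.2 0) *
            (avgKernel src tgt w (pV.2 (Fin.last (r + 1))) (ctwist z (pV.1 0)) *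
              ((∏ i, a (pV.2 i) ^ 2) * core src tgt w M r F pV.2))))
        (finSplit (Λ → H) (M + 3) (r + 2) V) := by
    intro V
    have h1 : ∫ E : Fin ((M + 3) + (r + 2)) → P → H, F (V, E) * ((∏ t, a (V t) ^ 2) *
          ∏ t, tempKernel src tgt w (V t) (E t) (ctwist (sm t) (V (finRotate _ t))))
        ∂(Measure.pi fun _ => Measure.pi fun _ : P => haarProbability H) =
        (∏ t, a (V t) ^ 2) * ∫ E : Fin ((M + 3) + (r + 2)) → P → H, F (V, E) *
          ∏ t, tempKernel src tgt w (V t) (E t) (ctwist (sm t) (V (finRotate _ t)))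
        ∂(Measure.pi fun _ => Measure.pi fun _ : P => haarProbability H) := by
      rw [← integral_const_mul]
      refine integral_congr_ae (Eventually.of_forall fun E => ?_)
      dsimp only
      ring
    rw [h1, integral_layers_fixedSlices src tgt w M r hFdep hsm₁ hsm₀ V,
      integral_blockLayers_eq_core src tgt w M r hFdep V, Fin.prod_univ_add]
    simp only [finSplit_fst, finSplit_snd]
    ring
  /- (B3) transport to (outer slices, block slices); integrability there -/
  have heV : MeasurePreserving (finSplit (Λ → H) (M + 3) (r + 2))
      (Measure.pi fun _ => Measure.pi fun _ : Λ => haarProbability H)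
      ((Measure.pi fun _ : Fin (M + 3) => Measure.pi fun _ : Λ => haarProbability H).prod
        (Measure.pi fun _ : Fin (r + 2) => Measure.pi fun _ : Λ => haarProbability H)) :=
    measurePreserving_finSplit' _ (M + 3) (r + 2)
  have hp1 : ∀ j, Measurable fun pV : (Fin (M + 3) → Λ → H) × (Fin (r + 2) → Λ → H) => pV.1 j :=
    fun j => (measurable_pi_apply j).comp measurable_fst
  have hp2 : ∀ i, Measurable fun pV : (Fin (M + 3) → Λ → H) × (Fin (r + 2) → Λ → H) => pV.2 i :=
    fun i => (measurable_pi_apply i).comp measurable_snd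
  have hcz : Measurable fun pV : (Fin (M + 3) → Λ → H) × (Fin (r + 2) → Λ → H) => ctwist z (pV.1 0) :=
    (continuous_ctwist z).measurable.comp (hp1 0)
  have hcore2 : Measurable fun pV : (Fin (M + 3) → Λ → H) × (Fin (r + 2) → Λ → H) => core src tgt w M r F pV.2 :=
    (measurable_core src tgt w hw M r hFm).comp measurable_snd
  have hGm : Measurable fun pV : (Fin (M + 3) → Λ → H) × (Fin (r + 2) → Λ → H) =>
      ((∏ j, a (pV.1 j) ^ 2) * ∏ j : Fin (M + 2), avgKernel src tgt w (pV.1 (Fin.castSucc j)) (pV.1 j.succ)) *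
          (avgKernel src tgt w (pV.1 (Fin.last (M + 2))) (pV.2 0) *
            (avgKernel src tgt w (pV.2 (Fin.last (r + 1))) (ctwist z (pV.1 0)) *
              ((∏ i, a (pV.2 i) ^ 2) * core src tgt w M r F pV.2))) :=
    ((Finset.measurable_prod _ fun j _ => (ha.comp (hp1 j)).pow_const 2).mul
      (Finset.measurable_prod _ fun j _ =>
        measurable_avgKernel_comp₂ src tgt w hw (hp1 (Fin.castSucc j)) (hp1 j.succ))).mul
      ((measurable_avgKernel_comp₂ src tgt w hw (hp1 (Fin.last (M + 2))) (hp2 0)).mul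
        ((measurable_avgKernel_comp₂ src tgt w hw (hp2 (Fin.last (r + 1))) hcz).mul
          ((Finset.measurable_prod _ fun i _ => (ha.comp (hp2 i)).pow_const 2).mul hcore2)))
  have hGb : ∀ pV : (Fin (M + 3) → Λ → H) × (Fin (r + 2) → Λ → H),
      ‖((∏ j, a (pV.1 j) ^ 2) * ∏ j : Fin (M + 2), avgKernel src tgt w (pV.1 (Fin.castSucc j)) (pV.1 j.succ)) *
          (avgKernel src tgt w (pV.1 (Fin.last (M + 2))) (pV.2 0) *
            (avgKernel src tgt w (pV.2 (Fin.last (r + 1))) (ctwist z (pV.1 0)) *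
              ((∏ i, a (pV.2 i) ^ 2) * core src tgt w M r F pV.2)))‖ ≤
      ((Ca ^ 2) ^ (M + 3) * (Cw ^ Fintype.card Λ) ^ (M + 2)) * (Cw ^ Fintype.card Λ * (Cw ^ Fintype.card Λ *
        ((Ca ^ 2) ^ (r + 2) * (nrm * (Cw ^ Fintype.card Λ) ^ (r + 1))))) := by
    intro pV
    rw [Real.norm_eq_abs]
    refine abs_mul_le_mul (abs_mul_le_mul (abs_prod_sq_le a haC pV.1)
      (abs_prod_avgKernel_le src tgt w hw0 hwC (fun j => pV.1 (Fin.castSucc j)) (fun j => pV.1 j.succ)))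
      (abs_mul_le_mul (abs_avgKernel_le src tgt w hw0 hwC _ _)
        (abs_mul_le_mul (abs_avgKernel_le src tgt w hw0 hwC _ _)
          (abs_mul_le_mul (abs_prod_sq_le a haC pV.2) ?_)))
    rw [← Real.norm_eq_abs]; exact norm_core_le src tgt w hw0 hwC M r hFb pV.2
  have hGint : Integrable (fun pV : (Fin (M + 3) → Λ → H) × (Fin (r + 2) → Λ → H) =>
      ((∏ j, a (pV.1 j) ^ 2) * ∏ j : Fin (M + 2), avgKernel src tgt w (pV.1 (Fin.castSucc j)) (pV.1 j.succ)) *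
          (avgKernel src tgt w (pV.1 (Fin.last (M + 2))) (pV.2 0) *
            (avgKernel src tgt w (pV.2 (Fin.last (r + 1))) (ctwist z (pV.1 0)) *
              ((∏ i, a (pV.2 i) ^ 2) * core src tgt w M r F pV.2))))
      ((Measure.pi fun _ : Fin (M + 3) => Measure.pi fun _ : Λ => haarProbability H).prod
        (Measure.pi fun _ : Fin (r + 2) => Measure.pi fun _ : Λ => haarProbability H)) :=
    (integrable_const _).mono' hGm.aestronglyMeasurable (Eventually.of_forall hGb)
  /- (D) the outer cycle relabelled by `(finRotate (M + 3)).symm` -/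
  have s0 : (finRotate (M + 3)).symm 0 = Fin.last (M + 2) := by
    rw [Equiv.symm_apply_eq]; exact finRotate_last.symm
  have s1 : (finRotate (M + 3)).symm 1 = 0 := by
    rw [Equiv.symm_apply_eq, finRotate_apply, zero_add]
  have s2 : ∀ t : Fin (M + 2), (finRotate (M + 3)).symm t.succ = Fin.castSucc t := fun t => by
    rw [Equiv.symm_apply_eq, finRotate_apply, Fin.coeSucc_eq_succ]
  have s3 : ∀ t : Fin (M + 2), (finRotate (M + 3)).symm (t.succ + 1) = t.succ := fun t => by
    rw [Equiv.symm_apply_eq, finRotate_apply]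
  calc ∫ V : Fin ((M + 3) + (r + 2)) → Λ → H, ∫ E : Fin ((M + 3) + (r + 2)) → P → H,
          (fun q : (Fin ((M + 3) + (r + 2)) → Λ → H) × (Fin ((M + 3) + (r + 2)) → P → H) =>
            F q * ((∏ t, a (q.1 t) ^ 2) *
              ∏ t, tempKernel src tgt w (q.1 t) (q.2 t) (ctwist (sm t) (q.1 (finRotate _ t))))) (V, E)
          ∂(Measure.pi fun _ => Measure.pi fun _ : P => haarProbability H)
        ∂(Measure.pi fun _ => Measure.pi fun _ : Λ => haarProbability H)
      = ∫ V : Fin ((M + 3) + (r + 2)) → Λ → H, (fun pV : (Fin (M + 3) → Λ → H) × (Fin (r + 2) → Λ → H) =>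
          ((∏ j, a (pV.1 j) ^ 2) * ∏ j : Fin (M + 2), avgKernel src tgt w (pV.1 (Fin.castSucc j)) (pV.1 j.succ)) *
          (avgKernel src tgt w (pV.1 (Fin.last (M + 2))) (pV.2 0) *
            (avgKernel src tgt w (pV.2 (Fin.last (r + 1))) (ctwist z (pV.1 0)) *
              ((∏ i, a (pV.2 i) ^ 2) * core src tgt w M r F pV.2))))
          (finSplit (Λ → H) (M + 3) (r + 2) V) ∂(Measure.pi fun _ => Measure.pi fun _ : Λ => haarProbability H) := by
        refine integral_congr_ae (Eventually.of_forall fun V => ?_)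
        dsimp only
        exact hV V
    _ = ∫ pV : (Fin (M + 3) → Λ → H) × (Fin (r + 2) → Λ → H),
          ((∏ j, a (pV.1 j) ^ 2) * ∏ j : Fin (M + 2), avgKernel src tgt w (pV.1 (Fin.castSucc j)) (pV.1 j.succ)) *
          (avgKernel src tgt w (pV.1 (Fin.last (M + 2))) (pV.2 0) *
            (avgKernel src tgt w (pV.2 (Fin.last (r + 1))) (ctwist z (pV.1 0)) *
              ((∏ i, a (pV.2 i) ^ 2) * core src tgt w M r F pV.2)))
        ∂((Measure.pi fun _ : Fin (M + 3) => Measure.pi fun _ : Λ => haarProbability H).prod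
          (Measure.pi fun _ : Fin (r + 2) => Measure.pi fun _ : Λ => haarProbability H)) :=
        heV.integral_comp' (fun pV : (Fin (M + 3) → Λ → H) × (Fin (r + 2) → Λ → H) =>
          ((∏ j, a (pV.1 j) ^ 2) * ∏ j : Fin (M + 2), avgKernel src tgt w (pV.1 (Fin.castSucc j)) (pV.1 j.succ)) *
          (avgKernel src tgt w (pV.1 (Fin.last (M + 2))) (pV.2 0) *
            (avgKernel src tgt w (pV.2 (Fin.last (r + 1))) (ctwist z (pV.1 0)) *
              ((∏ i, a (pV.2 i) ^ 2) * core src tgt w M r F pV.2))))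
    _ = ∫ Vo : Fin (M + 3) → Λ → H, ∫ Vb : Fin (r + 2) → Λ → H, (fun pV : (Fin (M + 3) → Λ → H) × (Fin (r + 2) → Λ → H) =>
          ((∏ j, a (pV.1 j) ^ 2) * ∏ j : Fin (M + 2), avgKernel src tgt w (pV.1 (Fin.castSucc j)) (pV.1 j.succ)) *
          (avgKernel src tgt w (pV.1 (Fin.last (M + 2))) (pV.2 0) *
            (avgKernel src tgt w (pV.2 (Fin.last (r + 1))) (ctwist z (pV.1 0)) *
              ((∏ i, a (pV.2 i) ^ 2) * core src tgt w M r F pV.2)))) (Vo, Vb)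
          ∂(Measure.pi fun _ : Fin (r + 2) => Measure.pi fun _ : Λ => haarProbability H)
        ∂(Measure.pi fun _ : Fin (M + 3) => Measure.pi fun _ : Λ => haarProbability H) := integral_prod _ hGint
    _ = ∫ Vo : Fin (M + 3) → Λ → H,
          (∫ u, sandKernel src tgt w a (Vo (Fin.last (M + 2))) u *
            ∫ v, blockKernel src tgt w a M r F u v * sandKernel src tgt w a (ctwist z⁻¹ v) (Vo 0)
            ∂(Measure.pi fun _ : Λ => haarProbability H) ∂(Measure.pi fun _ : Λ => haarProbability H)) *
          ∏ j : Fin (M + 2), sandKernel src tgt w a (Vo (Fin.castSucc j)) (Vo j.succ)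
        ∂(Measure.pi fun _ : Fin (M + 3) => Measure.pi fun _ : Λ => haarProbability H) := by
        refine integral_congr_ae (Eventually.of_forall fun Vo => ?_)
        dsimp only
        rw [integral_const_mul, ← block_inner src tgt w a hw hw0 hwC ha haC hz haT M r hFm hFb
          (Vo (Fin.last (M + 2))) (Vo 0)]
        have hsq : ∏ j : Fin (M + 3), a (Vo j) ^ 2 =
            a (Vo (Fin.last (M + 2))) * a (Vo 0) * ∏ j : Fin (M + 2), (a (Vo (Fin.castSucc j)) * a (Vo j.succ)) :=
          (prod_castSucc_mul_succ_eq_prod_sq (M + 1) (fun j => a (Vo j))).symm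
        rw [hsq]
        simp only [sandKernel, Finset.prod_mul_distrib]
        ring
    _ = ∫ V : Fin (M + 3) → Λ → H,
        (∫ u, sandKernel src tgt w a (V 0) u *
            ∫ v, blockKernel src tgt w a M r F u v * sandKernel src tgt w a (ctwist z⁻¹ v) (V 1)
            ∂(Measure.pi fun _ : Λ => haarProbability H) ∂(Measure.pi fun _ : Λ => haarProbability H)) *
          ∏ t : Fin (M + 2), sandKernel src tgt w a (V t.succ) (V (t.succ + 1))
      ∂(Measure.pi fun _ => Measure.pi fun _ : Λ => haarProbability H) := by
        rw [← Literature.Analysis.OperatorTheory.integral_pi_comp_perm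
          (ρ := Measure.pi fun _ : Λ => haarProbability H) (finRotate (M + 3)).symm
          (fun V : Fin (M + 3) → Λ → H =>
            (∫ u, sandKernel src tgt w a (V 0) u *
            ∫ v, blockKernel src tgt w a M r F u v * sandKernel src tgt w a (ctwist z⁻¹ v) (V 1)
            ∂(Measure.pi fun _ : Λ => haarProbability H) ∂(Measure.pi fun _ : Λ => haarProbability H)) *
          ∏ t : Fin (M + 2), sandKernel src tgt w a (V t.succ) (V (t.succ + 1)))]
        refine integral_congr_ae (Eventually.of_forall fun Vo => ?_)
        dsimp only
        simp only [s0, s1, s2, s3]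

end BlockChain

end Summit.QuantumFields.YangMills.Cruxes.IRcof.EquipartitionSeam.SliceKernel

end
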